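import Literature.Topology.FourManifolds.HCobordismBasisTheorem
import Literature.AlgebraicTopology.SingularHomology.CollapseMap
import Literature.AlgebraicTopology.SingularHomology.SimplyConnectedH1
import HarnessLib

/-!
# Wall 1964, Lemma 2, Morse-theoretic route: the homology of `(K, f⁻¹(a₀))` from that of `W`

Topic `Literature/Topology/FourManifolds` (fact seat
`provefact-Literature.Topology.FourManifolds.exists-68ee520c9a`, Wall 1964, Lemma 2,
`WallBoundingHandlebody.lean`; the homological half of item 1 of the route recorded there:
*"`Hᵢ(K, 𝕊⁴; ℤ)` is `ℤᵏ` for `i = 2` (`k = rank H₂(W)`) and `0` otherwise"*).  Everything here is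
**proved**; no named facts.

Setting: a Morse function `f` on a cobordism `c = (W; M, N)` (Milnor 1965, Def. 3.1), two
non-critical levels `0 < a < b < 1` with every critical value below `b`, such that the sublevel
set `W^a = {f ≤ a}` is contractible (in the application, the chart ball below the first level,
`WallHandlebodyBall.lean`).  Then for the slab `K = f⁻¹[a, b]` and its lower level `V = f⁻¹(a)`:

* `H⁎(K, V) ≅ H⁎(W^b, W^a)` (Milnor 1965, PDF p. 46, excision across the product collar of the
  level; the tree's `Cobordism.Milnor1965_slabHomology_iso_holds`);
* `H⁎(W^b, W^a) ≅ H⁎(W^1, W^a)` since the slab `f⁻¹[b, 1]` has no critical point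
  (`H⁎(W^1, W^b) = 0`, Cor. 3.15 in the vacuous case, `Cobordism.Milnor1965_homology_oneLevel_slab_holds`,
  and the exact sequence of the triple `W^a ⊆ W^b ⊆ W^1`, Hatcher p. 118);
* `W^1 = W`, and `H⁎(W, W^a)` is computed from the exact sequence of the pair (Hatcher Thm. 2.16)
  with `W^a` contractible: `Hᵢ(W) ≅ Hᵢ(W, W^a)` for `i ≥ 2`, `H₁(W, W^a) = 0` when `W` is simply
  connected (`H₁(W) = 0`, Hatcher Thm. 2A.1, and `H₀(W^a) → H₀(W)` is one-to-one), `H₀(W, W^a) = 0`.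

So (`isZero_relativeSingularHomology_slab`, `relativeSingularHomologySlabTwoIso`): if `W` is
simply connected with `Hᵢ(W; ℤ) = 0` for `i ≥ 3`, then `Hᵢ(K, V; ℤ) = 0` for `i ≠ 2` and
`H₂(K, V; ℤ) ≅ H₂(W; ℤ)`.  This is the input "`W` has the homology of a bouquet of `k` 2-spheres"
of Wall's Lemma 2 transported to the cobordism `K`.

## References

* C. T. C. Wall, *On simply-connected 4-manifolds*, J. London Math. Soc. 39 (1964), Lemma 2
  (pp. 143–144). [WallJLMS1964]
* J. Milnor, *Lectures on the h-cobordism theorem* (1965), Cor. 3.15, PDF pp. 46, 48.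
  [MilnorHCobordism1965]
* A. Hatcher, *Algebraic Topology* (2002), Prop. 2.7, Thm. 2.16, p. 118, Thm. 2A.1.
  [HatcherAT2002]
-/

open scoped Manifold ContDiff Topology
open Set Function CategoryTheory CategoryTheory.Limits
open Literature.AlgebraicTopology.SingularHomology

noncomputable section

universe u

namespace Literature.Topology.FourManifolds

/-- Local notation: `𝔼 n` is the model Euclidean space `EuclideanSpace ℝ (Fin n)`. -/
local notation "𝔼 " n:arg => EuclideanSpace ℝ (Fin n)

/-! ### The pair `(X, A)` with `A` contractible -/

section ContractiblePair

variable {X : Type u} [TopologicalSpace X] (A : Set X)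

/-- **`Hᵢ₊₂(X) ≅ Hᵢ₊₂(X, A)` for `A` contractible**: in the exact sequence of the pair
`Hᵢ₊₂(A) → Hᵢ₊₂(X) → Hᵢ₊₂(X, A) → Hᵢ₊₁(A)` the outer groups vanish (Hatcher 2002, Thm. 2.16
with Prop. 2.8). [cite: HatcherAT2002, Thm. 2.16 with Prop. 2.8] -/
theorem isIso_ofAbsolute_add_two_of_contractibleSpace [ContractibleSpace A] (i : ℕ) :
    IsIso (relativeSingularHomology.ofAbsolute ℤ ℤ X A (i + 2)) := by
  have hA2 : IsZero (singularHomology ℤ ℤ A (i + 2)) :=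
    isZero_singularHomology_of_contractibleSpace ℤ ℤ (by omega)
  have hA1 : IsZero (singularHomology ℤ ℤ A (i + 1)) :=
    isZero_singularHomology_of_contractibleSpace ℤ ℤ (by omega)
  haveI : Mono (relativeSingularHomology.ofAbsolute ℤ ℤ X A (i + 2)) :=
    (relativeSingularHomology.exact_map_ofAbsolute ℤ ℤ A (i + 2)).mono_g (hA2.eq_of_src _ _)
  haveI : Epi (relativeSingularHomology.ofAbsolute ℤ ℤ X A (i + 2)) :=
    (relativeSingularHomology.exact_ofAbsolute_δ ℤ ℤ A (i + 1)).epi_f (hA1.eq_of_tgt _ _)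
  exact isIso_of_mono_of_epi _

/-- **`H₁(X, A) = 0` for `X` simply connected and `A` contractible**: `H₁(X) = 0` (Hatcher
Thm. 2A.1), so `∂ : H₁(X, A) → H₀(A)` is one-to-one, and it is zero because `H₀(A) → H₀(X)` is
one-to-one for the path connected `A` (Prop. 2.7). [cite: HatcherAT2002, Thm. 2.16, Thm. 2A.1, Prop. 2.7] -/
theorem isZero_relativeSingularHomology_one_of_contractibleSpace [SimplyConnectedSpace X]
    [ContractibleSpace A] : IsZero (relativeSingularHomology ℤ ℤ X A 1) := by
  have hX1 : IsZero (singularHomology ℤ ℤ X 1) :=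
    isZero_singularHomology_one_of_simplyConnectedSpace ℤ ℤ
  haveI : Mono (relativeSingularHomology.δ ℤ ℤ X A 0) :=
    (relativeSingularHomology.exact_ofAbsolute_δ ℤ ℤ A 0).mono_g (hX1.eq_of_src _ _)
  haveI : Mono (singularHomology.map ℤ ℤ (⟨Subtype.val, continuous_subtype_val⟩ : C(A, X)) 0) :=
    singularHomology.mono_map_zero_of_pathConnectedSpace ℤ ℤ _
  have hδ : relativeSingularHomology.δ ℤ ℤ X A 0 = 0 :=
    zero_of_comp_mono (singularHomology.map ℤ ℤ (⟨Subtype.val, continuous_subtype_val⟩ : C(A, X)) 0)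
      (relativeSingularHomology.δ_comp_map ℤ ℤ A 0)
  exact IsZero.of_mono_eq_zero _ hδ

/-- **`H₀(X, A) = 0` for `X` path connected and `A` nonempty**: `H₀(A) → H₀(X)` is onto
(Prop. 2.7) and `H₀(X) → H₀(X, A)` is onto with kernel its image. [cite: HatcherAT2002, Thm. 2.16, Prop. 2.7] -/
theorem isZero_relativeSingularHomology_zero_of_nonempty [PathConnectedSpace X] [Nonempty A] :
    IsZero (relativeSingularHomology ℤ ℤ X A 0) := by
  haveI : Epi (singularHomology.map ℤ ℤ (⟨Subtype.val, continuous_subtype_val⟩ : C(A, X)) 0) :=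
    singularHomology.epi_map_zero_of_pathConnectedSpace ℤ ℤ _
  haveI := relativeSingularHomology.epi_ofAbsolute_zero ℤ ℤ (X := X) A
  have h0 : relativeSingularHomology.ofAbsolute ℤ ℤ X A 0 = 0 :=
    zero_of_epi_comp (singularHomology.map ℤ ℤ (⟨Subtype.val, continuous_subtype_val⟩ : C(A, X)) 0)
      (relativeSingularHomology.map_comp_ofAbsolute ℤ ℤ A 0)
  exact IsZero.of_epi_eq_zero _ h0

end ContractiblePair

/-! ### The slab `f⁻¹[a, b]` of a Morse function on a cobordism -/

section Slab

variable {n : ℕ} {M N : Type u} [TopologicalSpace M] [T2Space M] [SecondCountableTopology M]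
  [ChartedSpace (𝔼 n) M] [IsManifold (𝓡 n) ∞ M] [CompactSpace M]
  [TopologicalSpace N] [T2Space N] [SecondCountableTopology N] [ChartedSpace (𝔼 n) N]
  [IsManifold (𝓡 n) ∞ N] [CompactSpace N] {c : Cobordism n M N} {f : c.W → ℝ}

/-- **A slab without critical points has no relative homology**: if `0 ≤ b < 1` and every
critical value of the Morse function `f` on the cobordism is `< b`, then `H⁎(W^1, W^b; ℤ) = 0`
(Milnor 1965, Cor. 3.15 / Thm. 3.4 in the vacuous case of no critical point in `f⁻¹[b, 1]`; the
tree's `Cobordism.Milnor1965_homology_oneLevel_slab_holds`). [cite: MilnorHCobordism1965, Cor. 3.15 and Thm. 3.4 (PDF pp. 12, 19)] -/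
theorem isZero_sublevelHomology_one (hf : c.IsMorseFunction f) {b : ℝ} (hb0 : 0 ≤ b) (hb1 : b < 1)
    (hcrit : ∀ z ∈ criticalSet (𝓡∂ (n + 1)) f, f z < b) (i : ℕ) :
    IsZero (sublevelHomology f b 1 i) := by
  have h := (Cobordism.Milnor1965_homology_oneLevel_slab_holds hf hb0
    (show b < (b + 1) / 2 by linarith) (show (b + 1) / 2 < 1 by linarith) le_rfl (k := i + 1)
    (fun z hz hzI => absurd (hcrit z hz) (not_lt.2 hzI.1))).1
  exact h i (by omega)

/-- **Cutting off a collar without critical points does not change `H⁎(·, W^a)`**: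
`H⁎(W^b, W^a) → H⁎(W^1, W^a)` is an isomorphism when `f⁻¹[b, 1]` contains no critical point
(exact sequence of the triple `W^a ⊆ W^b ⊆ W^1`, Hatcher p. 118, with `H⁎(W^1, W^b) = 0`).
[cite: HatcherAT2002, §2.1, p. 118 (exact sequence of a triple)] [cite: MilnorHCobordism1965, Cor. 3.15] -/
theorem isIso_sublevelMap_one (hf : c.IsMorseFunction f) {a b : ℝ} (hab : a ≤ b) (hb0 : 0 ≤ b)
    (hb1 : b < 1) (hcrit : ∀ z ∈ criticalSet (𝓡∂ (n + 1)) f, f z < b) (i : ℕ) :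
    IsIso (sublevelMap f a hb1.le i) := by
  haveI : Mono (sublevelMap f a hb1.le i) :=
    (sublevel_exact₁ f hab hb1.le i).mono_g
      ((isZero_sublevelHomology_one hf hb0 hb1 hcrit (i + 1)).eq_of_src _ _)
  haveI : Epi (sublevelMap f a hb1.le i) :=
    (sublevel_exact₂ f hab hb1.le i).epi_f
      ((isZero_sublevelHomology_one hf hb0 hb1 hcrit i).eq_of_tgt _ _)
  exact isIso_of_mono_of_epi _

/-- **`H⁎(W^b, W^a) ≅ H⁎(W, W^a)`** under the same hypotheses (`W^1 = W` for a Morse function on a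
cobordism, whose values lie in `[0, 1]`). [cite: HatcherAT2002, §2.1, p. 118] [cite: MilnorHCobordism1965, Def. 3.1, Cor. 3.15] -/
def sublevelHomologyIsoPair (hf : c.IsMorseFunction f) {a b : ℝ} (hab : a ≤ b) (hb0 : 0 ≤ b)
    (hb1 : b < 1) (hcrit : ∀ z ∈ criticalSet (𝓡∂ (n + 1)) f, f z < b) (i : ℕ) :
    sublevelHomology f a b i ≅ relativeSingularHomology ℤ ℤ c.W {z | f z ≤ a} i :=
  haveI := isIso_sublevelMap_one hf hab hb0 hb1 hcrit i
  asIso (sublevelMap f a hb1.le i) ≪≫ sublevelHomologyTopIso f a (fun z => (hf.mem_Icc z).2) i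

/-- **`H⁎(f⁻¹[a, b], f⁻¹(a)) ≅ H⁎(W, W^a)`**: Milnor's `H⁎(W', V') ≅ H⁎(W ∪ W', W)` (PDF p. 46,
the tree's `Cobordism.Milnor1965_slabHomology_iso_holds`) followed by the previous
identification. [cite: MilnorHCobordism1965, PDF p. 46 (before Lemma 7.2)] [cite: HatcherAT2002, §2.1, p. 118] -/
def relativeSingularHomologySlabIsoPair (hf : c.IsMorseFunction f) {a b : ℝ} (ha : 0 < a) (hab : a < b)
    (hb1 : b < 1) (hrega : ∀ z ∈ criticalSet (𝓡∂ (n + 1)) f, f z ≠ a)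
    (hcrit : ∀ z ∈ criticalSet (𝓡∂ (n + 1)) f, f z < b) (i : ℕ) :
    relativeSingularHomology ℤ ℤ ↥(f ⁻¹' Icc a b) {z | f z.1 = a} i ≅
      relativeSingularHomology ℤ ℤ c.W {z | f z ≤ a} i :=
  haveI := Cobordism.Milnor1965_slabHomology_iso_holds hf ha hab
    (fun z hz => ⟨hrega z hz, (hcrit z hz).ne⟩) i
  asIso (relativeSingularHomology.map ℤ ℤ (slabToSublevel f a b) (mapsTo_slabToSublevel f a b) i) ≪≫
    sublevelHomologyIsoPair hf hab.le (ha.le.trans hab.le) hb1 hcrit i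

/-- **`Hᵢ(f⁻¹[a, b], f⁻¹(a); ℤ) = 0` for `i ≠ 2`** when `W` is simply connected with
`Hᵢ(W; ℤ) = 0` for `i ≥ 3` and the sublevel set `W^a` is contractible (Wall's hypothesis "`W` has
the homotopy type of a bouquet of 2-spheres" in its homological form, moved to the slab):
degrees `0`, `1` by the exact sequence of the pair `(W, W^a)` with `W^a` contractible and `W`
simply connected, degrees `≥ 3` by `Hᵢ(W, W^a) ≅ Hᵢ(W) = 0`.
[cite: WallJLMS1964, Lemma 2 (pp. 143–144)] [cite: HatcherAT2002, Thm. 2.16, Thm. 2A.1] -/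
theorem isZero_relativeSingularHomology_slab (hf : c.IsMorseFunction f) {a b : ℝ} (ha : 0 < a)
    (hab : a < b) (hb1 : b < 1) (hrega : ∀ z ∈ criticalSet (𝓡∂ (n + 1)) f, f z ≠ a)
    (hcrit : ∀ z ∈ criticalSet (𝓡∂ (n + 1)) f, f z < b) [ContractibleSpace ↥{z : c.W | f z ≤ a}]
    [SimplyConnectedSpace c.W] (hW : ∀ k, 3 ≤ k → IsZero (singularHomology ℤ ℤ c.W k))
    (i : ℕ) (hi : i ≠ 2) :
    IsZero (relativeSingularHomology ℤ ℤ ↥(f ⁻¹' Icc a b) {z | f z.1 = a} i) := by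
  refine IsZero.of_iso ?_ (relativeSingularHomologySlabIsoPair hf ha hab hb1 hrega hcrit i)
  haveI : Nonempty ↥{z : c.W | f z ≤ a} := inferInstance
  rcases i with _ | _ | _ | i
  · exact isZero_relativeSingularHomology_zero_of_nonempty _
  · exact isZero_relativeSingularHomology_one_of_contractibleSpace _
  · exact absurd rfl hi
  · haveI := isIso_ofAbsolute_add_two_of_contractibleSpace {z : c.W | f z ≤ a} (i + 1)
    exact (hW (i + 3) (by omega)).of_iso
      (asIso (relativeSingularHomology.ofAbsolute ℤ ℤ c.W {z : c.W | f z ≤ a} (i + 1 + 2))).symm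

/-- **`H₂(f⁻¹[a, b], f⁻¹(a); ℤ) ≅ H₂(W; ℤ)`** when the sublevel set `W^a` is contractible
(degree `2` of the exact sequence of the pair `(W, W^a)`). [cite: WallJLMS1964, Lemma 2 (pp. 143–144)] [cite: HatcherAT2002, Thm. 2.16 with Prop. 2.8] -/
def relativeSingularHomologySlabTwoIso (hf : c.IsMorseFunction f) {a b : ℝ} (ha : 0 < a)
    (hab : a < b) (hb1 : b < 1) (hrega : ∀ z ∈ criticalSet (𝓡∂ (n + 1)) f, f z ≠ a)
    (hcrit : ∀ z ∈ criticalSet (𝓡∂ (n + 1)) f, f z < b) [ContractibleSpace ↥{z : c.W | f z ≤ a}] :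
    relativeSingularHomology ℤ ℤ ↥(f ⁻¹' Icc a b) {z | f z.1 = a} 2 ≅ singularHomology ℤ ℤ c.W 2 :=
  haveI := isIso_ofAbsolute_add_two_of_contractibleSpace {z : c.W | f z ≤ a} 0
  relativeSingularHomologySlabIsoPair hf ha hab hb1 hrega hcrit 2 ≪≫
    (asIso (relativeSingularHomology.ofAbsolute ℤ ℤ c.W {z : c.W | f z ≤ a} 2)).symm

/-- **Rank bookkeeping**: under the hypotheses of `relativeSingularHomologySlabTwoIso`, if
`H₂(W; ℤ)` is finitely generated free then so is `H₂(f⁻¹[a, b], f⁻¹(a); ℤ)`, of the same rank.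
[cite: WallJLMS1964, Lemma 2 (pp. 143–144)] -/
theorem free_finite_finrank_relativeSingularHomology_slab_two (hf : c.IsMorseFunction f) {a b : ℝ}
    (ha : 0 < a) (hab : a < b) (hb1 : b < 1) (hrega : ∀ z ∈ criticalSet (𝓡∂ (n + 1)) f, f z ≠ a)
    (hcrit : ∀ z ∈ criticalSet (𝓡∂ (n + 1)) f, f z < b) [ContractibleSpace ↥{z : c.W | f z ≤ a}]
    [Module.Free ℤ (singularHomology ℤ ℤ c.W 2)] [Module.Finite ℤ (singularHomology ℤ ℤ c.W 2)] :
    Module.Free ℤ (relativeSingularHomology ℤ ℤ ↥(f ⁻¹' Icc a b) {z | f z.1 = a} 2) ∧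
      Module.Finite ℤ (relativeSingularHomology ℤ ℤ ↥(f ⁻¹' Icc a b) {z | f z.1 = a} 2) ∧
      Module.finrank ℤ (relativeSingularHomology ℤ ℤ ↥(f ⁻¹' Icc a b) {z | f z.1 = a} 2) =
        Module.finrank ℤ (singularHomology ℤ ℤ c.W 2) := by
  let e := (relativeSingularHomologySlabTwoIso hf ha hab hb1 hrega hcrit).toLinearEquiv
  exact ⟨Module.Free.of_equiv e.symm, Module.Finite.equiv e.symm, e.finrank_eq⟩

end Slab

end Literature.Topology.FourManifolds
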